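import Summits.HodgeConjecture.HodgeConjecture.Statement
import Literature.Geometry.Kaehler.SmoothHermitianBundleChernCharacter
import Literature.AlgebraicGeometry.HodgeTheory.HolomorphicBundleChernCharacter

/-!
# Birth skeleton (BC3) of the piece `ApproxHYMConiveauOne` (RIGIDITY; item stmt-HodgeConjecture-3028)

Crux-strategist `cstrat-stmt-HodgeConjecture-3025`, BC2-redirect of the deciding crux
`HodgeClassesConiveauOne` of route `HolomorphicDefect`.  Two registered stubs and the kernel-checked
composition; `sorry` only inside `stub_*`.

* `stub_holomorphicModelOffClosedSet` — the ANALYTIC HEART of the route (card holomorphic-defect-bubbling,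
  rigidity half): for a `C^∞` Hermitian bundle `F` on a Hodge model `A` of a smooth projective `X` which is
  approximately Hermitian–Yang–Mills for a (Kähler) metric `g` and has Hodge Chern character, and a class `c`
  with `A.pullback c = ch_p(F)`, `p ≥ 1`, there are a PROPER Zariski-closed `S ⊆ X` (all points of
  codimension `≥ 1`) and a class `a` in the `ℂ`-span of the `p`-th Chern characters of HOLOMORPHIC vector
  bundles on `X^an` such that `c - a` dies on `(X ∖ S)(ℂ)`.  Intended proof: a `δ_g`-minimising sequence of
  unitary connections on `F` converges modulo gauge, off a closed set `Σ` of finite `(2n-4)`-Hausdorff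
  measure, to an admissible HYM connection on `F|_{X ∖ Σ}` (Tian 2000 Thm. 4.3.3 for HYM sequences;
  Sedlacek 1982, Hong–Tian 2004, Petrache–Rivière 2017, Naber–Valtorta 2019 for the equation-free theory);
  `Σ ⊆ S`, `S` a proper ANALYTIC, hence (Chow) algebraic, subset (Tian 2000 Thm. 4.2.3 + King 1971); the
  `(0,1)`-part of the limit extends to a reflexive sheaf `𝓔` on `X^an` (Bando–Siu 1994), which has a finite
  resolution by holomorphic vector bundles on the projective `X^an` (Serre), so `a := ch_p(𝓔)` lies in the
  span of holomorphic-bundle Chern characters, and `ch_p(F)|_{X∖S} = ch_p(𝓔)|_{X∖S}` because `𝓔|_{X∖S}` is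
  the holomorphic bundle underlying `F|_{X∖S}` (Chern–Weil is natural under restriction).  OPEN as stated
  (the analyticity of the bubbling locus of a minimising — not HYM — sequence is the risk); HC-implied.
* `stub_span_holomorphicBundleChernCharacter_le_algebraicClasses` — Voisin I Thm. 11.32, inclusion `⊆`,
  tensored with `ℂ` (twist by an ample power, pull back Schubert cycles from a Grassmannian; GAGA): the
  `ℂ`-span of the Chern characters of holomorphic bundles on `X^an`, `X` smooth projective, consists of
  algebraic classes.  KNOWN theorem; in the tree only as (half of) the named fact
  `Literature.AlgebraicGeometry.HodgeTheory.span_holomorphicBundleChernCharacter_eq_algebraicClasses`.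
* `ApproxHYMConiveauOne_of_stubs` (no `sorry`): `c - a ∈ ker (H²ᵖ(X) → H²ᵖ(X ∖ S)) ⊆ N¹` by the defining
  generators of `supportedClasses`, `a ∈ Nᵖ ⊆ N¹` (`p ≥ 1`, `supportedClasses_mono`), and `c = (c - a) + a`.

The piece is restated here VERBATIM as a local `def` (self-contained version: it imports only the Statement cone and
Literature, so it elaborates independently of the route module's olean); the BY-NAME version concluding the route decl
is attached as evidence on stmt-HodgeConjecture-3025 (out/ApproxHYMConiveauOne-birth.lean) for registration with `ledger skeleton check --crux <piece item>`.
-/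

open scoped Manifold ContDiff

namespace Summit.HodgeConjecture.HodgeConjecture.Cruxes.ApproxHYMConiveauOne.Birth

open Literature.AlgebraicGeometry.Motives Literature.AlgebraicGeometry.HodgeTheory
  Literature.AlgebraicTopology.SingularHomology Literature.Geometry.Kaehler

/-- The piece (= item stmt-HodgeConjecture-3028 `ApproxHYMConiveauOne`, verbatim). -/
def ApproxHYMConiveauOne : Prop :=
  ∀ ⦃n : ℕ⦄ ⦃X : Literature.AlgebraicGeometry.Motives.SchemeOver ℂ⦄, Literature.AlgebraicGeometry.Motives.IsSmoothProjective n X → ∀ (A : Literature.AlgebraicGeometry.HodgeTheory.HodgeModel n X) (g : Bundle.ContMDiffRiemannianMetric 𝓘(ℝ, A.model) (⊤ : ℕ∞) A.model (fun x : A.carrier ↦ TangentSpace 𝓘(ℝ, A.model) x)) (F : Literature.Geometry.Kaehler.SmoothHermitianBundle A.model A.carrier), F.IsApproxHermitianYangMills g → (∀ k : ℕ, 1 ≤ k → F.chernCharacter A.deRham k ∈ A.hodgePQ (2 * k) k k) → ∀ (p : ℕ) (c : Literature.AlgebraicTopology.SingularHomology.singularCohomology ℂ ℂ (Literature.AlgebraicGeometry.Motives.ComplexPoints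 X) (2 * p)), 1 ≤ p → A.pullback (2 * p) c = F.chernCharacter A.deRham p → c ∈ Literature.AlgebraicGeometry.HodgeTheory.supportedClasses X (2 * p) 1

/-- **Stub R1 — holomorphic model off a proper closed subset (the analytic heart).** See the module
docstring. [Tian2000 Thm. 4.3.3, Rem. 6; BandoSiu1994; King1971; SerreGAGA1956] -/
theorem stub_holomorphicModelOffClosedSet :
    ∀ ⦃n : ℕ⦄ ⦃X : SchemeOver ℂ⦄, IsSmoothProjective n X →
      ∀ (A : HodgeModel n X)
        (g : Bundle.ContMDiffRiemannianMetric 𝓘(ℝ, A.model) (⊤ : ℕ∞) A.model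
          (fun x : A.carrier ↦ TangentSpace 𝓘(ℝ, A.model) x))
        (F : SmoothHermitianBundle A.model A.carrier),
        F.IsApproxHermitianYangMills g →
          (∀ k : ℕ, 1 ≤ k → F.chernCharacter A.deRham k ∈ A.hodgePQ (2 * k) k k) →
            ∀ (p : ℕ) (c : complexBetti X (2 * p)), 1 ≤ p →
              A.pullback (2 * p) c = F.chernCharacter A.deRham p →
                ∃ S : Set X.left, IsClosed S ∧ (∀ z ∈ S, ((1 : ℕ) : ℕ∞) ≤ Order.coheight z) ∧
                  ∃ a ∈ Submodule.span ℂ (A.holomorphicBundleChernCharacter p),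
                    complexBetti.restrictCompl X S (2 * p) (c - a) = 0 := by
  sorry

/-- **Stub R2 — Chern characters of holomorphic bundles on a smooth projective variety are algebraic
classes** (Voisin I, Thm. 11.32, `⊆`, ⊗ ℂ). [VoisinHodgeI2002 Thm. 11.32; SerreGAGA1956 n° 20 Prop. 18;
Fulton1998 Prop. 19.1.2] -/
theorem stub_span_holomorphicBundleChernCharacter_le_algebraicClasses :
    ∀ ⦃n : ℕ⦄ ⦃X : SchemeOver ℂ⦄, IsSmoothProjective n X →
      ∀ (A : HodgeModel n X) (p : ℕ),
        Submodule.span ℂ (A.holomorphicBundleChernCharacter p) ≤ algebraicClasses X p := by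
  sorry

/-- **Composition, implication form** (kernel-checked, no `sorry`): the two stub STATEMENTS imply the
piece. -/
theorem ApproxHYMConiveauOne_of_stubs
    (h1 : ∀ ⦃n : ℕ⦄ ⦃X : SchemeOver ℂ⦄, IsSmoothProjective n X →
      ∀ (A : HodgeModel n X)
        (g : Bundle.ContMDiffRiemannianMetric 𝓘(ℝ, A.model) (⊤ : ℕ∞) A.model
          (fun x : A.carrier ↦ TangentSpace 𝓘(ℝ, A.model) x))
        (F : SmoothHermitianBundle A.model A.carrier),
        F.IsApproxHermitianYangMills g →
          (∀ k : ℕ, 1 ≤ k → F.chernCharacter A.deRham k ∈ A.hodgePQ (2 * k) k k) →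
            ∀ (p : ℕ) (c : complexBetti X (2 * p)), 1 ≤ p →
              A.pullback (2 * p) c = F.chernCharacter A.deRham p →
                ∃ S : Set X.left, IsClosed S ∧ (∀ z ∈ S, ((1 : ℕ) : ℕ∞) ≤ Order.coheight z) ∧
                  ∃ a ∈ Submodule.span ℂ (A.holomorphicBundleChernCharacter p),
                    complexBetti.restrictCompl X S (2 * p) (c - a) = 0)
    (h2 : ∀ ⦃n : ℕ⦄ ⦃X : SchemeOver ℂ⦄, IsSmoothProjective n X →
      ∀ (A : HodgeModel n X) (p : ℕ),
        Submodule.span ℂ (A.holomorphicBundleChernCharacter p) ≤ algebraicClasses X p) :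
    ApproxHYMConiveauOne := by
  intro n X hX A g F hF hH p c hp hc
  obtain ⟨S, hS, hcod, a, ha, h0⟩ := h1 hX A g F hF hH p c hp hc
  have hca : c - a ∈ supportedClasses X (2 * p) 1 :=
    mem_supportedClasses_of_restrictCompl_eq_zero hS hcod h0
  have ha1 : a ∈ supportedClasses X (2 * p) 1 :=
    supportedClasses_mono X (2 * p) hp (h2 hX A p ha)
  have : c = (c - a) + a := (sub_add_cancel c a).symm
  rw [this]
  exact Submodule.add_mem _ hca ha1

/-- **The piece from its registered stubs, by name** (no `sorry` of its own). -/
theorem ApproxHYMConiveauOne_of : ApproxHYMConiveauOne :=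
  ApproxHYMConiveauOne_of_stubs stub_holomorphicModelOffClosedSet
    stub_span_holomorphicBundleChernCharacter_le_algebraicClasses

end Summit.HodgeConjecture.HodgeConjecture.Cruxes.ApproxHYMConiveauOne.Birth
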